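import Mathlib
import HarnessLib
import Literature.Computability.Complexity.CNF
import Literature.Computability.Complexity.PNPWave0
import Summits.PneNP.PneNP.Theorems.OverlapGapAlgebraSearchHardWindowLocalRungSigns
import Summits.PneNP.PneNP.Theorems.OverlapGapAlgebraSearchHardWindowLocalRungPatterns

/-!
# PneNP / OverlapGapAlgebra — `SearchHardWindow`: the unconditional occurrence-local rung

Support for crux `stmt-PneNP-2460` (`Summit.PneNP.PneNP.Theses.OverlapGapAlgebra.SearchHardWindow`),
whose hardness conjunct asks that every polynomial-time `f` solve `F_k(n, ⌊αn⌋)` with probability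
`→ 0`. Here the conjunct is proved UNCONDITIONALLY (no complexity hypothesis, no citation) for every
`k`, every `α > 1` — hence at the window density `α_k = 5·2^k log k/k` for every `k ≥ 2` — and
every OCCURRENCE-LOCAL solver: one whose output bit `x_v` is an arbitrary function
`R_v(polarities of v's own occurrences)`, the rules `R_v` chosen with full knowledge of the
variable pattern (hypergraph). The class contains the majority / threshold votes, "all true", and
the matched-formula (SDR / Hall) decoders — which are occurrence-local and succeed with
probability `→ 1` below the 1-orientability density `c*_k → 1` of the random `k`-uniform
hypergraph, so the threshold `α > 1` is nearly tight for the class; it is incomparable with the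
read-restricted classes of the query / sign / polarity / unread-polarity rungs (here every
polarity may be read) and with the `o(n)`-degree class of Line A.

* `shwL_ratio_le` — finite form: for parameters `Δ`, `r ≥ 1`, `n + r < m`, the solved fraction of
  `F_k(n, m)` is `≤ 4^k kΔ/(m - r - n) + (mkn + (mk)²)/((Δ+1)² n) + m k²/(r n)` (fixed-pattern
  rung of `…LocalRungSigns` on the typical patterns + the Markov bounds of `…LocalRungPatterns`).
* `shwL_ratio_eventually_le` — asymptotic form (`Δ = ⌊δn⌋`, `r = ⌊(α-1)n/3⌋ + 1`): success
  probability `→ 0` for every `α > 1`.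
* `shwL_hardnessConjunct_of_occurrenceLocal`, `shwL_hardnessConjunct_window` — the conjunct of the
  crux verbatim (`f : List Bool → List Bool`, `encodingCNF`, `List.getD` decoding), for `α > 1`
  resp. at `α_k` for `k ≥ 2` (`shwL_one_lt_windowDensity`);
* `shwL_majorityVote_eventually_le` — worked example: the majority-vote assignment fails, `α > 1`.

Mechanism (new among the rungs): a CONDITIONAL SECOND MOMENT given the variable pattern — at most
`n` weak slots by the pair constraint, `≥ m - n - r` good clauses each violated with probability
`≥ 4^{-k}`, variable-disjoint clauses independent, dependency degree `≤ kΔ`, so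
`Pr[solved | V] ≤ 4^k kΔ / #good`. No definitions; axioms `propext`, `Classical.choice`,
`Quot.sound`.
-/

set_option linter.dupNamespace false -- `Summit.PneNP.PneNP.…`: summit = sub-problem (D-0017)

namespace Summit.PneNP.PneNP.Theorems

open Finset

section Assembly

variable {m k n : ℕ}

/-- **Occurrence-local rung, all variable patterns (finite form).** Let `A` be an OCCURRENCE-LOCAL
solver of `F_k(n, m)`: on instances with the same variable pattern, output bit `v` depends only on
the polarities of the occurrences of `v`. Then for all parameters `Δ` and `r ≥ 1` with
`n + r < m`, the solved fraction is at most
`4^k kΔ / (m - r - n) + (mkn + (mk)²) / ((Δ+1)² n) + m k² / (r n)`: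
the first term from the fixed-pattern rung (`shwL_card_solved_signs_mul_le`) on the patterns with
all degrees `≤ Δ` and `< r` repeating clauses, the other two from Markov's inequality on the
exceptional patterns (`shwL_card_highDegree_mul_le`, `shwL_card_manyRepeats_mul_le`). -/
theorem shwL_ratio_le (A : (Fin m → Fin k → Fin n × Bool) → (Fin n → Bool))
    (hA : ∀ Φ Ψ : Fin m → Fin k → Fin n × Bool, (∀ i j, (Φ i j).1 = (Ψ i j).1) →
      ∀ v : Fin n, (∀ i j, (Φ i j).1 = v → (Φ i j).2 = (Ψ i j).2) → A Φ v = A Ψ v)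
    (Δ r : ℕ) (hr : 0 < r) (hn : 0 < n) (hm : n + r < m) :
    ((univ.filter fun Φ : Fin m → Fin k → Fin n × Bool =>
        ∀ i, ∃ j, A Φ (Φ i j).1 = (Φ i j).2).card : ℝ)
        / Fintype.card (Fin m → Fin k → Fin n × Bool)
      ≤ 4 ^ k * (k * Δ : ℝ) / ((m : ℝ) - r - n)
        + ((m * k * n + (m * k) ^ 2 : ℕ) : ℝ) / (((Δ + 1) ^ 2 * n : ℕ) : ℝ)
        + ((m * k ^ 2 : ℕ) : ℝ) / ((r * n : ℕ) : ℝ) := by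
  -- names for the counts (kept opaque)
  obtain ⟨NV, hNV⟩ : ∃ NV, NV = Fintype.card (Fin m × Fin k → Fin n) := ⟨_, rfl⟩
  obtain ⟨NS, hNS⟩ : ∃ NS, NS = Fintype.card (Fin m × Fin k → Bool) := ⟨_, rfl⟩
  obtain ⟨L, hL⟩ : ∃ L, L = m - r - n := ⟨_, rfl⟩
  obtain ⟨sol, hsol⟩ : ∃ sol : (Fin m × Fin k → Fin n) → ℕ, sol = fun V =>
      (univ.filter fun S : Fin m × Fin k → Bool =>
        ∀ i, ∃ j, A (fun i j => (V (i, j), S (i, j))) (V (i, j)) = S (i, j)).card := ⟨_, rfl⟩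
  obtain ⟨badD, hbadD⟩ : ∃ badD : Finset (Fin m × Fin k → Fin n), badD = univ.filter fun V =>
      ∃ v : Fin n, Δ + 1 ≤ (univ.filter fun a : Fin m × Fin k => V a = v).card := ⟨_, rfl⟩
  obtain ⟨badR, hbadR⟩ : ∃ badR : Finset (Fin m × Fin k → Fin n), badR = univ.filter fun V =>
      r ≤ (univ.filter fun i : Fin m => ¬ Function.Injective fun j : Fin k => V (i, j)).card :=
    ⟨_, rfl⟩
  have hNVpos : 0 < NV := by
    rw [hNV]; haveI : Nonempty (Fin n) := ⟨⟨0, hn⟩⟩; exact Fintype.card_pos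
  have hNSpos : 0 < NS := by rw [hNS]; exact Fintype.card_pos
  have hLpos : 0 < L := by rw [hL]; omega
  -- per-pattern bound on the good patterns
  have hgood : ∀ V : Fin m × Fin k → Fin n, V ∉ badD → V ∉ badR →
      sol V * L ≤ 4 ^ k * (k * Δ) * NS := by
    intro V hVD hVR
    have hdeg : ∀ v : Fin n, (univ.filter fun a : Fin m × Fin k => V a = v).card ≤ Δ := by
      intro v
      by_contra hv
      exact hVD (by rw [hbadD, mem_filter]; exact ⟨mem_univ _, v, by omega⟩)
    have hrep : (univ.filter fun i : Fin m =>
        ¬ Function.Injective fun j : Fin k => V (i, j)).card < r := by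
      by_contra hv
      exact hVR (by rw [hbadR, mem_filter]; exact ⟨mem_univ _, not_lt.1 hv⟩)
    have hsplit := Finset.card_filter_add_card_filter_not (s := (univ : Finset (Fin m)))
      (fun i : Fin m => Function.Injective fun j : Fin k => V (i, j))
    rw [card_univ, Fintype.card_fin] at hsplit
    have hLle : L ≤ (univ.filter fun i : Fin m =>
        Function.Injective fun j : Fin k => V (i, j)).card - n := by rw [hL]; omega
    have hfix := shwL_card_solved_signs_mul_le V (fun S => A fun i j => (V (i, j), S (i, j)))
      (fun v S S' hSS' => hA (fun i j => (V (i, j), S (i, j))) (fun i j => (V (i, j), S' (i, j)))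
        (fun _ _ => rfl) v fun i j hij => hSS' (i, j) hij) Δ hdeg
    rw [hsol, hNS]
    exact (Nat.mul_le_mul_left _ hLle).trans hfix
  -- every pattern: trivial bound
  have htriv : ∀ V : Fin m × Fin k → Fin n, sol V ≤ NS := by
    intro V; rw [hsol, hNS]; exact card_le_univ _
  -- sum over patterns
  have hsum : L * ∑ V : Fin m × Fin k → Fin n, sol V
      ≤ NV * (4 ^ k * (k * Δ) * NS) + L * NS * (badD.card + badR.card) := by
    have hpt : ∀ V : Fin m × Fin k → Fin n, L * sol V ≤ 4 ^ k * (k * Δ) * NS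
        + L * NS * ((if V ∈ badD then 1 else 0) + (if V ∈ badR then 1 else 0)) := by
      intro V
      have hbad : ∀ x : ℕ, L * sol V ≤ 4 ^ k * (k * Δ) * NS + L * NS * (x + 1) := fun x =>
        calc L * sol V ≤ L * NS := Nat.mul_le_mul_left _ (htriv V)
          _ ≤ L * NS * (x + 1) := Nat.le_mul_of_pos_right _ (Nat.succ_pos _)
          _ ≤ 4 ^ k * (k * Δ) * NS + L * NS * (x + 1) := Nat.le_add_left _ _
      by_cases hVD : V ∈ badD
      · simp only [hVD, if_true]
        rw [add_comm (1 : ℕ)]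
        exact hbad _
      · by_cases hVR : V ∈ badR
        · simp only [hVD, hVR, if_true, if_false]
          exact hbad _
        · simp only [hVD, hVR, if_false, add_zero, mul_zero]
          rw [mul_comm]; exact hgood V hVD hVR
    calc L * ∑ V : Fin m × Fin k → Fin n, sol V = ∑ V : Fin m × Fin k → Fin n, L * sol V := by
          rw [mul_sum]
      _ ≤ ∑ V : Fin m × Fin k → Fin n, (4 ^ k * (k * Δ) * NS
          + L * NS * ((if V ∈ badD then 1 else 0) + (if V ∈ badR then 1 else 0))) :=
          sum_le_sum fun V _ => hpt V
      _ = NV * (4 ^ k * (k * Δ) * NS) + L * NS * (badD.card + badR.card) := by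
          rw [sum_add_distrib, sum_const, card_univ, ← hNV, smul_eq_mul, ← mul_sum,
            sum_add_distrib, sum_boole, sum_boole, Nat.cast_id, Nat.cast_id]
          congr 3 <;> simp
  -- the two Markov bounds
  have hD : badD.card * (Δ + 1) ^ 2 * n ≤ (m * k * n + (m * k) ^ 2) * NV := by
    have := shwL_card_highDegree_mul_le (σ := Fin m × Fin k) (n := n) (Δ + 1)
    rw [Fintype.card_prod, Fintype.card_fin, Fintype.card_fin] at this
    rw [hbadD, hNV]
    exact this
  have hR : badR.card * r * n ≤ m * k ^ 2 * NV := by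
    rw [hbadR, hNV]; exact shwL_card_manyRepeats_mul_le r
  -- to real numbers
  rw [shwL_card_solved_eq_sum, shwL_card_inst_eq, ← hNV, ← hNS]
  have hsol' : (∑ V : Fin m × Fin k → Fin n, (univ.filter fun S : Fin m × Fin k → Bool =>
      ∀ i, ∃ j, A (fun i j => (V (i, j), S (i, j))) (V (i, j)) = S (i, j)).card)
        = ∑ V : Fin m × Fin k → Fin n, sol V := by rw [hsol]
  rw [hsol']
  have hLreal : (L : ℝ) = (m : ℝ) - r - n := by
    rw [hL, Nat.cast_sub (by omega), Nat.cast_sub (by omega)]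
  have hNV' : (0 : ℝ) < NV := by exact_mod_cast hNVpos
  have hNS' : (0 : ℝ) < NS := by exact_mod_cast hNSpos
  have hL' : (0 : ℝ) < L := by exact_mod_cast hLpos
  have hn' : (0 : ℝ) < n := by exact_mod_cast hn
  have hr' : (0 : ℝ) < r := by exact_mod_cast hr
  have hsumR : (L : ℝ) * ∑ V : Fin m × Fin k → Fin n, (sol V : ℝ)
      ≤ NV * (4 ^ k * (k * Δ) * NS) + L * NS * (badD.card + badR.card) := by
    have := hsum; rw [← Nat.cast_sum]; exact_mod_cast this
  have hDR : (badD.card : ℝ) * ((Δ : ℝ) + 1) ^ 2 * n ≤ ((m : ℝ) * k * n + ((m : ℝ) * k) ^ 2) * NV := by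
    exact_mod_cast hD
  have hRR : (badR.card : ℝ) * r * n ≤ (m : ℝ) * k ^ 2 * NV := by
    exact_mod_cast hR
  -- divide
  have h1 : (∑ V : Fin m × Fin k → Fin n, (sol V : ℝ)) / (NV * NS)
      ≤ 4 ^ k * (k * Δ) / L + (badD.card + badR.card) / NV := by
    rw [div_add_div _ _ hL'.ne' hNV'.ne', div_le_div_iff₀ (by positivity) (by positivity)]
    nlinarith [hsumR, hNV', hNS', hL']
  have h2 : ((badD.card : ℝ) + badR.card) / NV
      ≤ ((m * k * n + (m * k) ^ 2 : ℕ) : ℝ) / (((Δ + 1) ^ 2 * n : ℕ) : ℝ)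
        + ((m * k ^ 2 : ℕ) : ℝ) / ((r * n : ℕ) : ℝ) := by
    rw [add_div]
    push_cast
    refine add_le_add ?_ ?_
    · rw [div_le_div_iff₀ hNV' (by positivity)]
      nlinarith [hDR]
    · rw [div_le_div_iff₀ hNV' (by positivity)]
      nlinarith [hRR]
  push_cast [Nat.cast_sum] at h1 h2 ⊢
  rw [hLreal] at h1
  linarith [h1, h2]

end Assembly

section Asymptotic

open Filter
open Literature.Computability.Complexity

/-- **Occurrence-local rung, asymptotic form (abstract solvers, every `k`, every `α > 1`).** A
family of OCCURRENCE-LOCAL solvers `A n m` of `F_k(n, ⌊αn⌋)` — on instances with the same variable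
pattern, output bit `v` depends only on the polarities of the occurrences of `v` (majority or
threshold votes, matched-formula / SDR decoders, any rule `x_v = R_v(signs at v's slots)` chosen
with full knowledge of the hypergraph) — solves `F_k(n, ⌊αn⌋)` with probability `→ 0` whenever
`α > 1`. (Proof: `shwL_ratio_le` with `Δ = ⌊δn⌋`, `r = ⌊(α-1)n/3⌋ + 1`.) The density threshold is
nearly tight for the class: below the 1-orientability (SDR) density of the random `k`-uniform
hypergraph, which tends to `1` as `k → ∞`, the matched-formula decoder is occurrence-local and
succeeds with probability `→ 1`. -/
theorem shwL_ratio_eventually_le (k : ℕ) (α : ℝ) (hα : 1 < α)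
    (A : (n m : ℕ) → (Fin m → Fin k → Fin n × Bool) → (Fin n → Bool))
    (hA : ∀ᶠ n : ℕ in atTop, ∀ m : ℕ, m = ⌊α * n⌋₊ →
      ∀ Φ Ψ : Fin m → Fin k → Fin n × Bool, (∀ i j, (Φ i j).1 = (Ψ i j).1) →
        ∀ v : Fin n, (∀ i j, (Φ i j).1 = v → (Φ i j).2 = (Ψ i j).2) → A n m Φ v = A n m Ψ v)
    (ε : ℝ) (hε : 0 < ε) :
    ∀ᶠ n : ℕ in atTop, ∀ m : ℕ, m = ⌊α * n⌋₊ →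
      (((univ : Finset (Fin m → Fin k → Fin n × Bool)).filter fun Φ =>
          ∀ i, ∃ j, A n m Φ (Φ i j).1 = (Φ i j).2).card : ℝ)
        / Fintype.card (Fin m → Fin k → Fin n × Bool) ≤ ε := by
  -- constants
  set D₀ : ℝ := 4 ^ k * k with hD₀
  have hD₀nn : 0 ≤ D₀ := by positivity
  have hα1 : 0 < α - 1 := by linarith
  set δ : ℝ := ε * (α - 1) / (9 * (D₀ + 1)) with hδ
  have hδpos : 0 < δ := by positivity
  have hD₀δ : D₀ * δ ≤ ε * (α - 1) / 9 := by
    have h1 : D₀ * δ = D₀ / (D₀ + 1) * (ε * (α - 1) / 9) := by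
      rw [hδ]; field_simp
    rw [h1]
    exact mul_le_of_le_one_left (by positivity) ((div_le_one (by positivity)).2 (by linarith))
  -- the vanishing error terms and the size conditions
  have h2 : ∀ᶠ n : ℕ in atTop, (α * k + α ^ 2 * k ^ 2) / δ ^ 2 / (n : ℝ) ≤ ε / 3 :=
    (tendsto_const_div_atTop_nhds_zero_nat _).eventually (ge_mem_nhds (by positivity))
  have h3 : ∀ᶠ n : ℕ in atTop, 3 * α * k ^ 2 / (α - 1) / (n : ℝ) ≤ ε / 3 :=
    (tendsto_const_div_atTop_nhds_zero_nat _).eventually (ge_mem_nhds (by positivity))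
  have h0 : ∀ᶠ n : ℕ in atTop, 6 / (α - 1) ≤ (n : ℝ) :=
    tendsto_natCast_atTop_atTop.eventually_ge_atTop _
  filter_upwards [hA, h2, h3, h0, eventually_ge_atTop 1] with n hAn h2n h3n h0n hn1
  intro m hm
  -- parameters
  set Δ : ℕ := ⌊δ * n⌋₊ with hΔ
  set r : ℕ := ⌊(α - 1) / 3 * n⌋₊ + 1 with hr
  have hnpos : (0 : ℝ) < n := by exact_mod_cast hn1
  have hn6 : 6 ≤ (α - 1) * n := by
    have := (div_le_iff₀ hα1).1 h0n; linarith
  have hm_le : (m : ℝ) ≤ α * n := by rw [hm]; exact Nat.floor_le (by positivity)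
  have hm_ge : α * n - 1 ≤ (m : ℝ) := by
    rw [hm]; linarith [Nat.lt_floor_add_one (α * n)]
  have hr_le : (r : ℝ) ≤ (α - 1) / 3 * n + 1 := by
    rw [hr]; push_cast; linarith [Nat.floor_le (show 0 ≤ (α - 1) / 3 * n by positivity)]
  have hr_ge : (α - 1) / 3 * n ≤ (r : ℝ) := by
    rw [hr]; push_cast; linarith [Nat.lt_floor_add_one ((α - 1) / 3 * n)]
  have hΔ_le : (Δ : ℝ) ≤ δ * n := Nat.floor_le (by positivity)
  have hΔ_ge : δ * n ≤ (Δ : ℝ) + 1 := by linarith [Nat.lt_floor_add_one (δ * n)]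
  have hrpos : 0 < r := Nat.succ_pos _
  have hrpos' : (0 : ℝ) < r := by exact_mod_cast hrpos
  have hL : (α - 1) / 3 * n ≤ (m : ℝ) - r - n := by nlinarith
  have hLpos : 0 < (m : ℝ) - r - n := lt_of_lt_of_le (by positivity) hL
  have hnrm : n + r < m := by
    have : (n : ℝ) + r < m := by linarith
    exact_mod_cast this
  have hfin := shwL_ratio_le (A n m) (hAn m hm) Δ r hrpos hn1 hnrm
  -- term 1: the rung itself
  have t1 : 4 ^ k * (k * Δ : ℝ) / ((m : ℝ) - r - n) ≤ ε / 3 := by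
    rw [div_le_iff₀ hLpos]
    calc (4 : ℝ) ^ k * (k * Δ) = D₀ * Δ := by rw [hD₀]; ring
      _ ≤ D₀ * (δ * n) := mul_le_mul_of_nonneg_left hΔ_le hD₀nn
      _ = D₀ * δ * n := by ring
      _ ≤ ε * (α - 1) / 9 * n := mul_le_mul_of_nonneg_right hD₀δ hnpos.le
      _ = ε / 3 * ((α - 1) / 3 * n) := by ring
      _ ≤ ε / 3 * ((m : ℝ) - r - n) := mul_le_mul_of_nonneg_left hL (by positivity)
  -- term 2: high-degree patterns
  have t2 : ((m * k * n + (m * k) ^ 2 : ℕ) : ℝ) / (((Δ + 1) ^ 2 * n : ℕ) : ℝ) ≤ ε / 3 := by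
    have hC : α * k + α ^ 2 * k ^ 2 ≤ ε / 3 * (δ ^ 2 * n) := by
      have := h2n
      rw [div_div, div_le_iff₀ (by positivity)] at this
      linarith
    have hsq : (δ * n) ^ 2 ≤ ((Δ : ℝ) + 1) ^ 2 :=
      pow_le_pow_left₀ (by positivity) hΔ_ge 2
    push_cast
    rw [div_le_iff₀ (by positivity)]
    have hk0 : (0 : ℝ) ≤ k := Nat.cast_nonneg _
    have hm0 : (0 : ℝ) ≤ m := Nat.cast_nonneg _
    calc (m : ℝ) * k * n + ((m : ℝ) * k) ^ 2
        ≤ α * n * k * n + (α * n * k) ^ 2 := by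
          have h1 : (m : ℝ) * k ≤ α * n * k := mul_le_mul_of_nonneg_right hm_le hk0
          nlinarith [h1, mul_nonneg hm0 hk0]
      _ = (α * k + α ^ 2 * k ^ 2) * n ^ 2 := by ring
      _ ≤ ε / 3 * (δ ^ 2 * n) * n ^ 2 := mul_le_mul_of_nonneg_right hC (by positivity)
      _ = ε / 3 * ((δ * n) ^ 2 * n) := by ring
      _ ≤ ε / 3 * (((Δ : ℝ) + 1) ^ 2 * n) := by
          refine mul_le_mul_of_nonneg_left (mul_le_mul_of_nonneg_right hsq hnpos.le) ?_
          positivity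
  -- term 3: repeating clauses
  have t3 : ((m * k ^ 2 : ℕ) : ℝ) / ((r * n : ℕ) : ℝ) ≤ ε / 3 := by
    have hC : 3 * α * k ^ 2 / (α - 1) ≤ ε / 3 * n := (div_le_iff₀ hnpos).1 h3n
    push_cast
    rw [div_le_iff₀ (by positivity)]
    have hk0 : (0 : ℝ) ≤ (k : ℝ) ^ 2 := by positivity
    calc (m : ℝ) * k ^ 2 ≤ α * n * k ^ 2 := mul_le_mul_of_nonneg_right hm_le hk0
      _ = 3 * α * k ^ 2 / (α - 1) * ((α - 1) / 3 * n) := by field_simp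
      _ ≤ ε / 3 * n * ((α - 1) / 3 * n) := mul_le_mul_of_nonneg_right hC (by positivity)
      _ ≤ ε / 3 * n * r := mul_le_mul_of_nonneg_left hr_ge (by positivity)
      _ = ε / 3 * (r * n) := by ring
  linarith [hfin, t1, t2, t3]

/-- **Example: the majority vote fails.** The majority-vote assignment (each variable set to the
majority polarity of its occurrences, ties broken towards `true`; it may be computed in linear
time) is occurrence-local, so it solves `F_k(n, ⌊αn⌋)` with probability `→ 0` for every `k` and
every `α > 1`. -/
theorem shwL_majorityVote_eventually_le (k : ℕ) (α : ℝ) (hα : 1 < α) (ε : ℝ) (hε : 0 < ε) :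
    ∀ᶠ n : ℕ in atTop, ∀ m : ℕ, m = ⌊α * n⌋₊ →
      (((univ : Finset (Fin m → Fin k → Fin n × Bool)).filter fun Φ =>
          ∀ i, ∃ j, decide ((univ.filter fun a : Fin m × Fin k => (Φ a.1 a.2).1 = (Φ i j).1).card
              ≤ 2 * (univ.filter fun a : Fin m × Fin k =>
                (Φ a.1 a.2).1 = (Φ i j).1 ∧ (Φ a.1 a.2).2 = true).card) = (Φ i j).2).card : ℝ)
        / Fintype.card (Fin m → Fin k → Fin n × Bool) ≤ ε := by
  refine shwL_ratio_eventually_le k α hα (fun n m Φ v =>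
    decide ((univ.filter fun a : Fin m × Fin k => (Φ a.1 a.2).1 = v).card
      ≤ 2 * (univ.filter fun a : Fin m × Fin k => (Φ a.1 a.2).1 = v ∧ (Φ a.1 a.2).2 = true).card))
    (Eventually.of_forall fun n m _ Φ Ψ hV v hS => ?_) ε hε
  have h1 : (univ.filter fun a : Fin m × Fin k => (Φ a.1 a.2).1 = v)
      = univ.filter fun a : Fin m × Fin k => (Ψ a.1 a.2).1 = v := by
    ext a; simp [hV a.1 a.2]
  have h2 : (univ.filter fun a : Fin m × Fin k => (Φ a.1 a.2).1 = v ∧ (Φ a.1 a.2).2 = true)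
      = univ.filter fun a : Fin m × Fin k => (Ψ a.1 a.2).1 = v ∧ (Ψ a.1 a.2).2 = true := by
    ext a
    simp only [mem_filter, mem_univ, true_and]
    constructor
    · rintro ⟨ha, hb⟩; exact ⟨(hV a.1 a.2) ▸ ha, (hS a.1 a.2 ha) ▸ hb⟩
    · rintro ⟨ha, hb⟩
      have ha' : (Φ a.1 a.2).1 = v := (hV a.1 a.2).trans ha
      exact ⟨ha', (hS a.1 a.2 ha').symm ▸ hb⟩
  rw [h1, h2]

/-- **Occurrence-local rung for the crux's hardness conjunct (verbatim shape).** For ANY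
`f : List Bool → List Bool` (no complexity hypothesis) and any `α > 1`: if, eventually in `n`,
the decoded assignment `v ↦ (f ⌜Φ⌝).getD v false` on instances `Φ` of `F_k(n, ⌊αn⌋)` is
occurrence-local — instances with the same variable pattern and the same polarities on the
occurrences of `v` get the same bit `v` — then `f` satisfies the hardness conjunct of
`SearchHardWindow` at `(k, α)`: its success ratio is eventually `≤ ε` for every `ε > 0`. In
particular this holds at the window density `α_k = 5·2^k log k / k` for every `k ≥ 2`
(`shwL_hardnessConjunct_window`). -/
theorem shwL_hardnessConjunct_of_occurrenceLocal (k : ℕ) (α : ℝ) (hα : 1 < α)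
    (f : List Bool → List Bool)
    (hf : ∀ᶠ n : ℕ in atTop, ∀ m : ℕ, m = ⌊α * n⌋₊ →
      ∀ Φ Ψ : Fin m → Fin k → Fin n × Bool, (∀ i j, (Φ i j).1 = (Ψ i j).1) →
        ∀ v : Fin n, (∀ i j, (Φ i j).1 = v → (Φ i j).2 = (Ψ i j).2) →
          (f (encodingCNF.encode (List.ofFn fun a => List.ofFn fun b =>
              (((Φ a b).1 : ℕ), (Φ a b).2)))).getD v false
            = (f (encodingCNF.encode (List.ofFn fun a => List.ofFn fun b =>
              (((Ψ a b).1 : ℕ), (Ψ a b).2)))).getD v false) :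
    ∀ ε : ℝ, 0 < ε → ∀ᶠ n : ℕ in Filter.atTop, ∀ m : ℕ, m = ⌊α * n⌋₊ →
      ((Finset.univ.filter fun Φ : Fin m → Fin k → Fin n × Bool => ∀ i, ∃ j,
          (f (Literature.Computability.Complexity.encodingCNF.encode (List.ofFn fun a =>
            List.ofFn fun b => (((Φ a b).1 : ℕ), (Φ a b).2)))).getD (Φ i j).1 false =
              (Φ i j).2).card : ℝ) / Fintype.card (Fin m → Fin k → Fin n × Bool) ≤ ε := by
  intro ε hε
  exact shwL_ratio_eventually_le k α hα
    (fun n m Φ v => (f (encodingCNF.encode (List.ofFn fun a => List.ofFn fun b =>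
      (((Φ a b).1 : ℕ), (Φ a b).2)))).getD v false) hf ε hε

/-- The window density of the crux exceeds `1` for every `k ≥ 2`:
`1 < 5 · 2^k · log k / k` (indeed `2^k ≥ 2k` and `log k ≥ log 2 > 0.69`). -/
theorem shwL_one_lt_windowDensity {k : ℕ} (hk : 2 ≤ k) : 1 < 5 * 2 ^ k * Real.log k / k := by
  have hkpos : (0 : ℝ) < k := by exact_mod_cast (show 0 < k by omega)
  have hlog : Real.log 2 ≤ Real.log k :=
    Real.log_le_log (by norm_num) (by exact_mod_cast hk)
  have hlog2 : (0.6931471803 : ℝ) < Real.log 2 := Real.log_two_gt_d9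
  have hpow : (2 : ℝ) * k ≤ 2 ^ k := by
    have : ∀ j : ℕ, 2 * (j + 1) ≤ 2 ^ (j + 1) := by
      intro j
      induction j with
      | zero => norm_num
      | succ j ih => rw [pow_succ]; omega
    obtain ⟨j, rfl⟩ : ∃ j, k = j + 1 := ⟨k - 1, by omega⟩
    exact_mod_cast this j
  rw [lt_div_iff₀ hkpos]
  nlinarith [hlog, hlog2, hpow, hkpos]

/-- **Occurrence-local rung at the window.** For every `k ≥ 2` and every `f : List Bool → List Bool`
whose decoded output on `F_k(n, ⌊α_k n⌋)`, `α_k = 5·2^k log k/k`, is eventually occurrence-local,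
`f` satisfies the hardness conjunct of `SearchHardWindow` at `(k, α_k)` — unconditionally. -/
theorem shwL_hardnessConjunct_window (k : ℕ) (hk : 2 ≤ k) (f : List Bool → List Bool)
    (hf : ∀ᶠ n : ℕ in atTop, ∀ m : ℕ, m = ⌊5 * 2 ^ k * Real.log k / k * n⌋₊ →
      ∀ Φ Ψ : Fin m → Fin k → Fin n × Bool, (∀ i j, (Φ i j).1 = (Ψ i j).1) →
        ∀ v : Fin n, (∀ i j, (Φ i j).1 = v → (Φ i j).2 = (Ψ i j).2) →
          (f (encodingCNF.encode (List.ofFn fun a => List.ofFn fun b =>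
              (((Φ a b).1 : ℕ), (Φ a b).2)))).getD v false
            = (f (encodingCNF.encode (List.ofFn fun a => List.ofFn fun b =>
              (((Ψ a b).1 : ℕ), (Ψ a b).2)))).getD v false) :
    ∀ ε : ℝ, 0 < ε → ∀ᶠ n : ℕ in Filter.atTop, ∀ m : ℕ, m = ⌊5 * 2 ^ k * Real.log k / k * n⌋₊ →
      ((Finset.univ.filter fun Φ : Fin m → Fin k → Fin n × Bool => ∀ i, ∃ j,
          (f (Literature.Computability.Complexity.encodingCNF.encode (List.ofFn fun a =>
            List.ofFn fun b => (((Φ a b).1 : ℕ), (Φ a b).2)))).getD (Φ i j).1 false =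
              (Φ i j).2).card : ℝ) / Fintype.card (Fin m → Fin k → Fin n × Bool) ≤ ε :=
  shwL_hardnessConjunct_of_occurrenceLocal k _ (shwL_one_lt_windowDensity hk) f hf

end Asymptotic

end Summit.PneNP.PneNP.Theorems
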